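import Summits.CriticalPhenomena.PercolationContinuityZ3.Theorems.PercNearOneGluingNoHeavyLowerTailSahiCombTriWAndOr2

/-!
# AND with a block on three coordinates: row bookkeeping for `P₁ ∧ Q`, `Q ⊆ 2^{Fin 3}` (infrastructure for the OR₃ and `x ∨ yz` certificates)

Support file of the one-cut programme (crux `NoHeavyLowerTail`, stmt-CriticalPhenomena-4575; unit `prim-lf-1` gen 43, memo
`FROM-prim-lf-1-gen43-AND-MAJ3.md` §4; landed gen 45).  Generic pieces used by the machine-found certificates for `AndShellLower` with a second block
`Q ⊆ 2^{Fin 3}`: the indicator expansion of `#(R ∩ X ∩ Y)`, the sum over the eight subsets of `Fin 3`, unit-vector facts for the row atoms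
`x ↦ [x ⊔ y ∈ A] − [xᶜ ⊔ y' ∈ A]` (`y' ⊆ y`) on an arbitrary block, and their acuteness over an intersecting Kleitman shell `P₁`.
HONEST LABEL: bookkeeping only, complete proofs, std axioms. [this work]
-/

namespace Summit.CriticalPhenomena.PercolationContinuityZ3.Theorems

namespace FiveUpSet

open Finset

variable {β γ₁ δ : Type} [DecidableEq β] [Fintype β] [DecidableEq γ₁] [Fintype γ₁] [DecidableEq δ] [Fintype δ]

omit [Fintype δ] in
/-- `#(R ∩ X ∩ Y) = Σ_{y∈R} [y∈X][y∈Y]`. [this work] -/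
theorem card_inter_inter_eq_sum_ind' (R X Y : Finset (Finset δ)) :
    ((R ∩ X ∩ Y).card : ℤ) = ∑ y ∈ R, ind X y * ind Y y := by
  rw [inter_assoc, ← filter_mem_eq_inter, card_eq_sum_ones, Nat.cast_sum, sum_filter]
  refine sum_congr rfl fun y _ => ?_
  unfold ind
  by_cases hX : y ∈ X <;> by_cases hY : y ∈ Y <;> simp [hX, hY, mem_inter]

/-- The eight subsets of `Fin 3`. [this work] -/
theorem univ_finset_fin3 : (univ : Finset (Finset (Fin 3))) = {∅, {0}, {1}, {0,1}, {2}, {0,2}, {1,2}, univ} := by decide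

/-- A sum over all subsets of `Fin 3`, expanded. [this work] -/
theorem sum_powerset_fin3 (f : Finset (Fin 3) → ℤ) :
    ∑ y : Finset (Fin 3), f y = f ∅ + f {0} + f {1} + f {0,1} + f {2} + f {0,2} + f {1,2} + f univ := by
  rw [univ_finset_fin3, sum_insert (by decide), sum_insert (by decide), sum_insert (by decide), sum_insert (by decide),
    sum_insert (by decide), sum_insert (by decide), sum_insert (by decide), sum_singleton]
  ring

/-- The four subsets of `Fin 2`. [this work] -/
theorem univ_finset_fin2 : (univ : Finset (Finset (Fin 2))) = {∅, {0}, {1}, univ} := by decide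

/-- A sum over all subsets of `Fin 2`, expanded. [this work] -/
theorem sum_powerset_fin2 (f : Finset (Fin 2) → ℤ) :
    ∑ y : Finset (Fin 2), f y = f ∅ + f {0} + f {1} + f univ := by
  rw [univ_finset_fin2, sum_insert (by decide), sum_insert (by decide), sum_insert (by decide), sum_singleton]
  ring

/-- A sum over a sub-family as an `ite`-sum over the whole power set (any block). [this work] -/
theorem sum_mem_eq_sum_ite (R : Finset (Finset δ)) (f : Finset δ → ℤ) :
    ∑ y ∈ R, f y = ∑ y : Finset δ, (if y ∈ R then f y else 0) := by
  rw [← sum_filter]; congr 1; ext y; simp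

/-- Complement table in `Fin 3`. [this work] -/
theorem compl_fin3_0 : ({0} : Finset (Fin 3))ᶜ = {1, 2} := by decide
/-- Complement table in `Fin 3`. [this work] -/
theorem compl_fin3_1 : ({1} : Finset (Fin 3))ᶜ = {0, 2} := by decide
/-- Complement table in `Fin 3`. [this work] -/
theorem compl_fin3_01 : ({0, 1} : Finset (Fin 3))ᶜ = {2} := by decide
/-- Complement table in `Fin 3`. [this work] -/
theorem compl_fin3_2 : ({2} : Finset (Fin 3))ᶜ = {0, 1} := by decide
/-- Complement table in `Fin 3`. [this work] -/
theorem compl_fin3_02 : ({0, 2} : Finset (Fin 3))ᶜ = {1} := by decide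
/-- Complement table in `Fin 3`. [this work] -/
theorem compl_fin3_12 : ({1, 2} : Finset (Fin 3))ᶜ = {0} := by decide

section unitfacts
variable {A : Finset (Finset (γ₁ ⊕ δ))} (hA : IsUpperSet (A : Set (Finset (γ₁ ⊕ δ))))
include hA

omit [Fintype δ] in
/-- Unit-vector facts for `x ↦ [x⊔y ∈ A] − [xᶜ⊔y' ∈ A]` with `y' ⊆ y` (any block). [this work] -/
theorem diffInd_facts' {y y' : Finset δ} (hyy : y' ⊆ y) :
    (∀ x : Finset γ₁, -1 ≤ ind A (x.disjSum y) - ind A (xᶜ.disjSum y') ∧ ind A (x.disjSum y) - ind A (xᶜ.disjSum y') ≤ 1) ∧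
    (∀ x x' : Finset γ₁, x ⊆ x' → ind A (x.disjSum y) - ind A (xᶜ.disjSum y') ≤ ind A (x'.disjSum y) - ind A (x'ᶜ.disjSum y')) ∧
    (∀ x x' : Finset γ₁, x ∪ x' = univ →
      0 ≤ (ind A (x.disjSum y) - ind A (xᶜ.disjSum y')) + (ind A (x'.disjSum y) - ind A (x'ᶜ.disjSum y'))) := by
  refine ⟨fun x => ?_, fun x x' h => ?_, fun x x' h => ?_⟩
  · have h1 := ind_nonneg_le_one A (x.disjSum y); have h2 := ind_nonneg_le_one A (xᶜ.disjSum y')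
    constructor <;> linarith
  · have h1 := ind_mono_pt hA (disjSum_mono h (le_refl y))
    have h2 := ind_mono_pt hA (disjSum_mono (compl_subset_compl.2 h) (le_refl y'))
    linarith
  · have hc : xᶜ ⊆ x' := by
      intro a ha; rw [mem_compl] at ha
      have := mem_univ a; rw [← h, mem_union] at this; tauto
    have hc' : x'ᶜ ⊆ x := by
      intro a ha; rw [mem_compl] at ha
      have := mem_univ a; rw [← h, mem_union] at this; tauto
    have h1 := ind_mono_pt hA (disjSum_mono hc hyy)
    have h2 := ind_mono_pt hA (disjSum_mono hc' hyy)
    linarith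

end unitfacts

section acute
variable {P₁ : Finset (Finset γ₁)} (hP : IsUpperSet (P₁ : Set (Finset γ₁))) (hd : Disjoint P₁ (refl P₁))
  (hcor : ∀ U V : Finset (Finset γ₁), IsUpperSet (U : Set (Finset γ₁)) → IsUpperSet (V : Set (Finset γ₁)) → 0 ≤ corP P₁ U V)
include hP hd hcor

omit [Fintype δ] in
/-- Acuteness of two row atoms (any blocks `δ`). [this work] -/
theorem sum_diffInd_mul_nonneg' {A B : Finset (Finset (γ₁ ⊕ δ))} (hA : IsUpperSet (A : Set (Finset (γ₁ ⊕ δ))))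
    (hB : IsUpperSet (B : Set (Finset (γ₁ ⊕ δ)))) {y y' z z' : Finset δ} (hyy : y' ⊆ y) (hzz : z' ⊆ z) :
    0 ≤ ∑ x ∈ P₁, (ind A (x.disjSum y) - ind A (xᶜ.disjSum y')) * (ind B (x.disjSum z) - ind B (xᶜ.disjSum z')) := by
  obtain ⟨bA, mA, pA⟩ := diffInd_facts' hA hyy
  obtain ⟨bB, mB, pB⟩ := diffInd_facts' hB hzz
  refine sum_mul_nonneg_of_unit hP hd hcor (fun x => ind A (x.disjSum y) - ind A (xᶜ.disjSum y'))
    (fun x => ind B (x.disjSum z) - ind B (xᶜ.disjSum z')) ?_ ?_ (fun x _ x' _ h => mA x x' h) (fun x _ x' _ h => mB x x' h)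
    (fun x _ x' _ h => pA x x' h) (fun x _ x' _ h => pB x x' h)
  · intro x _; have := bA x; omega
  · intro x _; have := bB x; omega

omit [Fintype δ] in
/-- Acuteness of a row atom against the constant `1` (the constant is the `δ`-vector of `P₁` itself). [this work] -/
theorem sum_diffInd_nonneg {B : Finset (Finset (γ₁ ⊕ δ))} (hB : IsUpperSet (B : Set (Finset (γ₁ ⊕ δ)))) {z z' : Finset δ} (hzz : z' ⊆ z) :
    0 ≤ ∑ x ∈ P₁, (ind B (x.disjSum z) - ind B (xᶜ.disjSum z')) := by
  obtain ⟨bB, mB, pB⟩ := diffInd_facts' hB hzz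
  have h := sum_mul_nonneg_of_unit hP hd hcor (fun _ => (1 : ℤ)) (fun x => ind B (x.disjSum z) - ind B (xᶜ.disjSum z'))
    (fun _ _ => by norm_num) ?_ (fun _ _ _ _ _ => le_refl _) (fun x _ x' _ h => mB x x' h) (fun _ _ _ _ _ => by norm_num)
    (fun x _ x' _ h => pB x x' h)
  · simpa using h
  · intro x _; have := bB x; omega

end acute

end FiveUpSet

end Summit.CriticalPhenomena.PercolationContinuityZ3.Theorems
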